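import Summits.RiemannHypothesis.RiemannHypothesis.Theorems.TiltedLandingLaw421R3BotQ
import Summits.RiemannHypothesis.RiemannHypothesis.Theorems.TiltedLandingLaw421R3SuccNested
import Summits.RiemannHypothesis.RiemannHypothesis.Theorems.TiltedLandingLaw421R3SuccWindowCase

/-!
# The RESIDUAL IMPLICATION for `stub_restSuccBotQ`

SUPPORT module for crux `TiltedLandingLaw421` (stmt-RiemannHypothesis-24774), `--supports … --as helper` only.

★ `restSuccBotQ_of_residual`: If the NEGATED-WINDOW RESIDUAL holds (for every legal frame, if a charged level
has no successor AND there is no all-in-band in-range window around the lowest band state, then the frame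
is FALSE), then `RestSuccBotQ` holds.

This composes:
- BRANCH 1 (`stTrkDQ_succ_of_nested` from R3SuccNested): nested successor ⇒ StTrkDQ (j+1)
- (B1) (`readyR2_of_window_noSucc` from R3SuccWindowCase): window + no successor ⇒ ReadyR2 ⇒ contradiction
- (B2) the residual hypothesis: ¬window ⇒ False

The proof structure:
1. Start with a charged level j
2. By `chargedBot_iffQ`, get the lowest band state v with ¬ReadyR2, no s/4-drop successor
3. DICHOTOMY: `by_cases ∃ u', StTrkDQ (j+1) u'`
   - `pos`: Done
   - `neg`: hempty in hand
     - `by_cases AllInBandInRangeWindow ...`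
       - `pos` (B1): `readyR2_of_window_noSucc` gives ReadyR2, contradicts hnr
       - `neg` (B2): apply the residual hypothesis to get False

Per SUMMON 074506Z: the negated-window hypothesis is typed as the verbatim negation of (B1)'s window
conjunction from clusterStep v4 `band_successor_or_nlEvent_of_window`.

Typed ≠ proved; RH is NOT proved; 24774 OPEN.
-/

set_option linter.dupNamespace false

namespace RhW08.SuccB

open Complex Set
open RhIdea6.G17.W07C7 RhIdea6.G17.W07C7.Rev6 RhIdea6.G18.W07C8.Law421BirthS RhIdea6.G19.W07C11.Seam
open RhIdea6.G20.W07C12.Frac RhIdea6.G20.W07C12.StColP RhW07.C12.FieldSplit RhIdea6.G21.W07C13.TentMax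
open RhW07.C14.TwoSided RhW07.C14.Classes RhW07.C14.Lineage RhW07.C14.Booking
open RhW07.C13.Heredity RhIdea6.G22.W07C15pre.Injection RhW07.E3.Cell RhW07.E3.Lit
open RhW08.Round1 RhW08.StSwap RhW08.Round2 RhW08.QuadW RhW08.SealSwapQ RhW08.SealSwap

/-- The NEGATED-WINDOW RESIDUAL hypothesis: for every legal frame, if the lowest `StTrkDQ` state `v` at a
charged level has no `StTrkDQ` successor at level `j+1` AND there is no all-in-band in-range window
around `v`, then the frame is FALSE (contradiction).

This is what remains to be proved after (B1); it is the «anti-ESCAPE» statement per critic RESULT-12: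
in an in-range event-free Jensen window holding a band state, some non-real zero of f^{(j+1)} in the box
has |Re w − x₀| ≤ R/2 (strip heredity → StTrkDQ (j+1)) or is in the band aperture. -/
def NegatedWindowResidual : Prop :=
  ∀ (η : ℝ) (f : ℂ → ℂ) (x₀ s hmax R Hs : ℝ) (B : ℕ),
    EngineHyps5 2 η f x₀ s hmax R Hs B →
    ∀ (j : ℕ) (v : ℂ),
      IsLowest StTrkDQ η f x₀ s hmax R Hs B j v →
      ¬ ReadyR2 η f x₀ s hmax R Hs B j v →
      (∀ u' : ℂ, ¬ StTrkDQ η f x₀ s hmax R Hs B (j + 1) u') →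
      ¬ AllInBandInRangeWindow f x₀ R Hs j v →
      False

/-- ★★ **THE RESIDUAL IMPLICATION**. If the negated-window residual holds, then `RestSuccBotQ` holds.

This composes Branch 1 (`stTrkDQ_succ_of_nested`) and (B1) (`readyR2_of_window_noSucc`) with the
residual hypothesis (B2). -/
theorem restSuccBotQ_of_residual (hR : NegatedWindowResidual) : RestSuccBotQ := by
  intro η f x₀ s hmax R Hs B hE j hC
  -- Unpack the charged predicate
  rw [chargedBot_iffQ] at hC
  obtain ⟨v, hlow, hnr, _hno_drop⟩ := hC
  -- hlow : IsLowest StTrkDQ η f x₀ s hmax R Hs B j v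
  -- hnr : ¬ ReadyR2 η f x₀ s hmax R Hs B j v
  -- v is a StTrkDQ state (from IsLowest)
  have hv : StTrkDQ η f x₀ s hmax R Hs B j v := hlow.1
  -- DICHOTOMY: is there a level-(j+1) band state?
  by_cases hS : ∃ u' : ℂ, StTrkDQ η f x₀ s hmax R Hs B (j + 1) u'
  · -- Case pos: successor exists
    exact hS
  · -- Case neg: no successor
    push Not at hS
    -- hS : ∀ u', ¬ StTrkDQ (j+1) u'
    -- DICHOTOMY: is there an all-in-band in-range window?
    by_cases hW : AllInBandInRangeWindow f x₀ R Hs j v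
    · -- Case (B1): window exists — apply readyR2_of_window_noSucc
      exfalso
      have hready := readyR2_of_window_noSucc hE hv hS hW
      exact hnr hready
    · -- Case (B2): no window — apply the residual hypothesis
      exfalso
      exact hR η f x₀ s hmax R Hs B hE j v hlow hnr hS hW

end RhW08.SuccB
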